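import Summits.QuantumFields.YangMills.Theorems.BalabanUVNodesK0Stub1ChartDAnalytic
import HarnessLib

/-!
# K0⁷ STUB 1 (`stub_prop8StepCoP13`), sub-target S4b — THE CHART BLOCK OF THE SECT. F CAPSTONE AT THE RECORD, part 8:
# **SELECTOR-INDEPENDENCE OF THE TRUE CHART AND OF ITS DERIVATIVE** — any two solution families of (49) obeying the (55) bound (dag-n07-w2's `Dv`∕`Dfun` of
# `N07ChartDOfRecord`∕`N07ChartDDerivative`, part 2's analytic selector, part 6's `Dfun`) COINCIDE on the weighted `ε`-ball, and so do their Fréchet derivatives there —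
# so a letter proved for ONE selector's `𝔇 = fderiv D` (e.g. the (73) norm bound of p606148, or a future (73)ᵀ column letter `θ₀`) transfers to every other

Cell `pub-ymgap`, width seat `pub-ymgap-k0-s1-w2` g3 (INTENT-8).  `--kind proof --supports stmt-QuantumFields-20541 --as helper`; count-neutral.
[15] = [Balaban1985Variational].

WHAT IS PROVED (sorry-free; no definition; axioms standard; fibre `M_n(ℂ)`).  Binders = part 2's `section Solution` binders for TWO maps `D₁`, `D₂`.
* ★ `chartD_selectors_eq` — `D₁ A′ = D₂ A′` at every `A′` of the ball (`chartD_unique`).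
* ★ `chartD_selectors_eventuallyEq` — `D₁ =ᶠ[𝓝 A′] D₂` there (the ball is open).
* ★★ `fderiv_chartD_selectors_eq` — `fderiv ℂ D₁ A′ = fderiv ℂ D₂ A′` at every `A′` of the ball (`Filter.EventuallyEq.fderiv_eq`).
HONEST SCOPE.  Glue only; nothing of [15] asserted; `stub_prop8StepCoP13` ∕ K0⁷ NOT closed; N07 NOT discharged; counts unmoved (28∕28 · 5∕27); one finite 𝕋⁴ programme at
fixed ε — R4 closes the conditional finite-𝕋⁴ rung `BalabanLadder.UV` only, never the summit; the YM mass gap (Clay) is NOT proved by any of this; nothing continuum ∕ ℝ⁴ ∕ OS.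
No `sorry`, no `def`, no `instance`, no `notation`.

References: [15] (49)–(55) pp.285–286, (73) p.289, Prop. 3 p.289.
-/

noncomputable section

open scoped BigOperators Matrix.Norms.L2Operator Topology ContDiff
open NormedSpace Metric Set Filter

namespace Summit.QuantumFields.YangMills.Theorems.K0Stub1ChartDSelectorsAgree

open Literature.MathematicalPhysics.QuantumFieldTheory.Balaban1983to89
open Literature.MathematicalPhysics.QuantumFieldTheory.Balaban1983to89.B6SectADomainsV1 (Domains)
open Literature.MathematicalPhysics.QuantumFieldTheory.Balaban1983to89.B6SectAOperatorsV1 (BondIdx)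
open Summit.QuantumFields.YangMills.Theorems.FlatCubeOpsText (Adm22)
open Summit.QuantumFields.YangMills.Theorems.K0FlatCubeOpsTextP (IsLevWeight)
open Summit.QuantumFields.YangMills.Theorems.Prop8Chart (chartLog)
open Summit.QuantumFields.YangMills.Theorems.K0Stub1ChartDAnalytic (chartD_unique window_of_h18 isOpen_weightedBall)

variable {P : Params} {n : Type*} [Fintype n] [DecidableEq n] [Nonempty n]

section TwoSelectors

variable (k : ℕ) {R' M : ℕ} (hR'L : 2 * P.L ≤ R') (hM : 1 ≤ M) (D : Domains P) (hDk : D.k = k) (hAdm : Adm22 D R' M)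
    {w : ℕ → PBond P 0 → ℝ} (hw : IsLevWeight P k D w)
    (H : (BondIdx D → Matrix n n ℂ) →ₗ[ℂ] (PBond P 0 → Matrix n n ℂ))
    (hHinv : ∀ X, (fderiv ℂ (chartLog (((P.L : ℝ)⁻¹) ^ k) D : (PBond P 0 → Matrix n n ℂ) → BondIdx D → Matrix n n ℂ) 0) (H X) = X)
    {B₀ : ℝ} (hB₀ : 0 ≤ B₀)
    (hHB : ∀ (X : BondIdx D → Matrix n n ℂ) (t : ℝ), 0 ≤ t → (∀ i, ‖X i‖ ≤ t) → ∀ b, w 1 b * ‖H X b‖ ≤ B₀ * t)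
    {ε : ℝ} (hε : 0 < ε)
    (h18 : 18 * (960 * (((P.d + 2) * P.L : ℕ) : ℝ) * (P.L : ℝ) / (12800 * (((P.d + 2) * P.L : ℕ) : ℝ) ^ 2 * (P.L : ℝ))⁻¹) * B₀ * ε ≤ 1)
    (h2 : 64 * ε ≤ (12800 * (((P.d + 2) * P.L : ℕ) : ℝ) ^ 2 * (P.L : ℝ))⁻¹)
    (D₁ D₂ : (PBond P 0 → Matrix n n ℂ) → (BondIdx D → Matrix n n ℂ))
    (h55₁ : ∀ A' : PBond P 0 → Matrix n n ℂ, (∀ b, w 1 b * ‖A' b‖ < ε) →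
      ∀ ρ : ℝ, 0 ≤ ρ → (∀ b, w 1 b * ‖A' b‖ ≤ ρ) →
        ∀ i, ‖D₁ A' i‖ ≤ 4 * (960 * (((P.d + 2) * P.L : ℕ) : ℝ) * (P.L : ℝ) / (12800 * (((P.d + 2) * P.L : ℕ) : ℝ) ^ 2 * (P.L : ℝ))⁻¹) * ρ ^ 2)
    (h49₁ : ∀ A' : PBond P 0 → Matrix n n ℂ, (∀ b, w 1 b * ‖A' b‖ < ε) →
      chartLog (((P.L : ℝ)⁻¹) ^ k) D (A' - H (D₁ A')) -
        (fderiv ℂ (chartLog (((P.L : ℝ)⁻¹) ^ k) D : (PBond P 0 → Matrix n n ℂ) → BondIdx D → Matrix n n ℂ) 0) (A' - H (D₁ A')) = D₁ A')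
    (h55₂ : ∀ A' : PBond P 0 → Matrix n n ℂ, (∀ b, w 1 b * ‖A' b‖ < ε) →
      ∀ ρ : ℝ, 0 ≤ ρ → (∀ b, w 1 b * ‖A' b‖ ≤ ρ) →
        ∀ i, ‖D₂ A' i‖ ≤ 4 * (960 * (((P.d + 2) * P.L : ℕ) : ℝ) * (P.L : ℝ) / (12800 * (((P.d + 2) * P.L : ℕ) : ℝ) ^ 2 * (P.L : ℝ))⁻¹) * ρ ^ 2)
    (h49₂ : ∀ A' : PBond P 0 → Matrix n n ℂ, (∀ b, w 1 b * ‖A' b‖ < ε) →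
      chartLog (((P.L : ℝ)⁻¹) ^ k) D (A' - H (D₂ A')) -
        (fderiv ℂ (chartLog (((P.L : ℝ)⁻¹) ^ k) D : (PBond P 0 → Matrix n n ℂ) → BondIdx D → Matrix n n ℂ) 0) (A' - H (D₂ A')) = D₂ A')

include hR'L hM hDk hAdm hw hHinv hB₀ hHB hε h18 h2 h55₁ h49₁ h55₂ h49₂

/-- ★ **TWO SOLUTION FAMILIES OF (49) WITH THE (55) BOUND COINCIDE ON THE BALL** (uniqueness of the small fixed point, dag-n07-w2's (ii)).
[cite: Balaban1985Variational, (49)-(55) pp.285-286, Prop. 3 p.289] -/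
theorem chartD_selectors_eq (A' : PBond P 0 → Matrix n n ℂ) (hA' : ∀ b, w 1 b * ‖A' b‖ < ε) : D₁ A' = D₂ A' := by
  have hL0 : (0 : ℝ) < P.L := by exact_mod_cast P.L_pos
  have hℓ1 : (1 : ℝ) ≤ (((P.d + 2) * P.L : ℕ) : ℝ) := by
    exact_mod_cast Nat.one_le_iff_ne_zero.mpr (Nat.mul_ne_zero (by omega) (by have := P.hL.2; omega))
  have hC₂ : 0 ≤ 960 * (((P.d + 2) * P.L : ℕ) : ℝ) * (P.L : ℝ) / (12800 * (((P.d + 2) * P.L : ℕ) : ℝ) ^ 2 * (P.L : ℝ))⁻¹ := by positivity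
  obtain ⟨hq, h3⟩ := window_of_h18 hC₂ hB₀ hε h18 h2
  exact chartD_unique k hR'L hM D hDk hAdm hw H hHinv hB₀ hHB hε hq h3 A' hA' _ _
    (h55₁ A' hA' ε hε.le (fun b => (hA' b).le)) (h49₁ A' hA') (h55₂ A' hA' ε hε.le (fun b => (hA' b).le)) (h49₂ A' hA')

/-- ★ The two families agree on a NEIGHBOURHOOD of every point of the ball (the ball is open). [cite: Balaban1985Variational, Prop. 3 p.289] -/
theorem chartD_selectors_eventuallyEq (A' : PBond P 0 → Matrix n n ℂ) (hA' : ∀ b, w 1 b * ‖A' b‖ < ε) : D₁ =ᶠ[𝓝 A'] D₂ := by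
  filter_upwards [(isOpen_weightedBall (n := n) w ε).mem_nhds hA'] with Y hY
  exact chartD_selectors_eq k hR'L hM D hDk hAdm hw H hHinv hB₀ hHB hε h18 h2 D₁ D₂ h55₁ h49₁ h55₂ h49₂ Y hY

/-- ★★ **…AND SO DO THEIR FRÉCHET DERIVATIVES**: `fderiv ℂ D₁ A′ = fderiv ℂ D₂ A′` on the ball — a letter for one selector's `𝔇 = fderiv D` (the (73) norm bound of
dag-n07-w2's `exists_chartD_hasFDerivAt`, a future (73)ᵀ column letter) is a letter for every other's. [cite: Balaban1985Variational, (73) p.289, Prop. 3 p.289] -/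
theorem fderiv_chartD_selectors_eq (A' : PBond P 0 → Matrix n n ℂ) (hA' : ∀ b, w 1 b * ‖A' b‖ < ε) : fderiv ℂ D₁ A' = fderiv ℂ D₂ A' :=
  (chartD_selectors_eventuallyEq k hR'L hM D hDk hAdm hw H hHinv hB₀ hHB hε h18 h2 D₁ D₂ h55₁ h49₁ h55₂ h49₂ A' hA').fderiv_eq

end TwoSelectors

-- (dag-n07-w2's record edition with analyticity added is their `N07Prop3AtRecordAnalytic.exists_prop3_T4_analytic`, p612807 — not restated here.)

end Summit.QuantumFields.YangMills.Theorems.K0Stub1ChartDSelectorsAgree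

end
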